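import Summits.BirchSwinnertonDyer.BirchSwinnertonDyer.Theorems.ResidualThetaTransportAtTwoSignedControlAtTwoOfPub
import Literature.NumberTheory.EllipticCurves.Greenberg1999.LocalQuotientControlSurjectiveProofs
import HarnessLib

/-!
# K4 `SignedControlAtTwo` (stmt-BirchSwinnertonDyer-20309) FROM FOUR PRINTED FACTS — the honest PUB residue of line `eulerchar`
# (routes `ThetaPartnerAtTwo` / `ResidualThetaTransportAtTwo`; both copies of the decl)

Crux K4, line `eulerchar` (lead `prover-bsd-wall-tp2-p3` g2, skeleton v6 8d2b4be25f391f24); seat `prover-bsd-wall-tp2-p3-w3` (width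
seat 3/3, g2).

WHY. With HONDA⁺@2 a theorem (`Cruxes.SignedControlAtTwo.EulerChar.stub_plusHondaSystemTwo`, width seat 2, p591589), width seat 2's
`SignedControlAtTwoOfPubProof.signedControlAtTwo_of_pub` (`…ResidualThetaTransportAtTwoSignedControlAtTwoOfPub`) derives K4 from the
FIVE named facts of the v6 PUB conjunction. One of the five, Greenberg's p. 108 local-quotient surjectivity
`Greenberg1999.localQuotient_restriction_surjective ℚ`, is PROVED in the tree (`Greenberg1999.localQuotient_restriction_surjective_holds`,
`Literature/…/Greenberg1999/LocalQuotientControlSurjectiveProofs`, cell bsd-2adic). THIS FILE records the honest residue kernel-exactly: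
**K4 ⟸ FOUR printed facts** {Cassels' theorem (Greenberg Prop. 4.13 special case), Greenberg Prop. 4.12, the corank bound pp. 119–120,
weak Leopoldt §5 p. 140 / Kato Thm. 12.4}, for BOTH route copies of the decl (their bodies coincide) — the one-line closer for a
PUB-alias item with four antecedents.

WHAT. `signedControlAtTwo_of_pub4` (TP2 decl), `signedControlAtTwo_rtt_of_pub4` (RTT decl). CONDITIONAL results (the gate records
`proof.conditional`); THEOREMS ONLY (no definition, no named fact, no instance, no `sorry`); closes no item by itself; BSD is not proved
by any of this.

References: [GreenbergLNM1716] R. Greenberg, LNM 1716 (1999), §4 Props. 4.12–4.13, pp. 108, 119–122, §5 p. 140; [Cassels1964ArithmeticVII];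
[Kato2004Asterisque] Thm. 12.4; [BDKim2013] Cor. 3.15; [Kobayashi2003] Thm. 1.2, §8.4.
-/

set_option autoImplicit false
-- the Theorems namespace of this sub repeats the summit name by design (D-0017 nested layout)
set_option linter.dupNamespace false

noncomputable section

namespace Summit.BirchSwinnertonDyer.BirchSwinnertonDyer.Theorems.SignedEC.OfPubFour

open Literature.NumberTheory.EllipticCurves

/-- **K4 `SignedControlAtTwo` (route `ThetaPartnerAtTwo`'s decl, BY NAME) from the FOUR printed facts of Greenberg LNM 1716 that the
tree does not prove** — Cassels' theorem, Prop. 4.12, the `ℤ_p`-corank bound, weak Leopoldt — the fifth antecedent of width seat 2's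
`signedControlAtTwo_of_pub` being the tree theorem `Greenberg1999.localQuotient_restriction_surjective_holds`.
[cite: GreenbergLNM1716, Props. 4.12–4.13, pp. 108, 119–122, 140] [cite: Kato2004Asterisque, Thm. 12.4] [cite: BDKim2013, Cor. 3.15] -/
theorem signedControlAtTwo_of_pub4 (hC : Greenberg1999.casselsSurjectivity_H1Sigma ℚ)
    (h412 : Greenberg1999.prop412_noFiniteSubmodule_H1Sigma_of_rank_one) (hcork : Greenberg1999.h1Sigma_zpCorank_le_degree ℚ)
    (hWL : Greenberg1999.h1SigmaInfty_rank_eq_one) :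
    Summit.BirchSwinnertonDyer.BirchSwinnertonDyer.Theses.ThetaPartnerAtTwo.SignedControlAtTwo :=
  SignedControlAtTwoOfPubProof.signedControlAtTwo_of_pub hC h412 hcork Greenberg1999.localQuotient_restriction_surjective_holds hWL

/-- **The same for route `ResidualThetaTransportAtTwo`'s copy of the decl** (identical body). [cite: GreenbergLNM1716, Props. 4.12–4.13,
pp. 108, 119–122, 140] [cite: Kato2004Asterisque, Thm. 12.4] -/
theorem signedControlAtTwo_rtt_of_pub4 (hC : Greenberg1999.casselsSurjectivity_H1Sigma ℚ)
    (h412 : Greenberg1999.prop412_noFiniteSubmodule_H1Sigma_of_rank_one) (hcork : Greenberg1999.h1Sigma_zpCorank_le_degree ℚ)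
    (hWL : Greenberg1999.h1SigmaInfty_rank_eq_one) :
    Summit.BirchSwinnertonDyer.BirchSwinnertonDyer.Theses.ResidualThetaTransportAtTwo.SignedControlAtTwo :=
  SignedControlAtTwoOfPubProof.signedControlAtTwo_of_pub hC h412 hcork Greenberg1999.localQuotient_restriction_surjective_holds hWL

end Summit.BirchSwinnertonDyer.BirchSwinnertonDyer.Theorems.SignedEC.OfPubFour

end
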